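import Summits.RiemannHypothesis.RiemannHypothesis.Theorems.WeilGroundStateGroundStatesConvergeToXiStubWeilArchPolarDominated
import Summits.RiemannHypothesis.RiemannHypothesis.Theorems.WeilGroundStateGroundStatesConvergeToXiStubWeilFunctionalDominated
import Summits.RiemannHypothesis.RiemannHypothesis.Theorems.WeilGroundStateGroundStatesConvergeToXiStubWeilConvPairing
import Summits.RiemannHypothesis.RiemannHypothesis.Theorems.WeilGroundStateGroundStatesConvergeToXiStubGroundStateEulerLagrangeStrong
import Summits.RiemannHypothesis.RiemannHypothesis.Theorems.WeilGroundStateGroundStatesConvergeToXiStubWeightedL1OfWeakLimit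
import Summits.RiemannHypothesis.RiemannHypothesis.Theorems.WeilGroundStateGroundStatesConvergeToXiStubPhiTranslateAvgHarmonic
import Summits.RiemannHypothesis.RiemannHypothesis.Theorems.WeilGroundStateGroundStatesConvergeToXiHarmonicClosure
import Summits.RiemannHypothesis.RiemannHypothesis.Theorems.WeilGroundStateGroundStatesConvergeToXiRHofTight
import Summits.RiemannHypothesis.RiemannHypothesis.Theorems.WeilGroundStateGroundStatesConvergeToXiEnergyLimit
import Literature.NumberTheory.LFunctions.WeilExplicit
import Literature.NumberTheory.LFunctions.WeilExplicitProofs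
import Literature.NumberTheory.LFunctions.WeilGroundEnergyProofs
import Literature.NumberTheory.LFunctions.WeilGroundState
import Literature.NumberTheory.LFunctions.WeilWindowSimpleEven
import Mathlib.Analysis.Distribution.AEEqOfIntegralContDiff
import HarnessLib

/-!
# `WeilGroundState.GroundStatesConvergeToXi` — TIGHT WEAK LIMITS OF RENORMALISED GROUND STATES ARE
WEIL-HARMONIC (RH-free), and the harmonic class is not rigid
(crux item stmt-RiemannHypothesis-1527, route route-RiemannHypothesis-WeilGroundState; line `Sketch`,
lead file of rev L11, continuation lead c9; `--supports`)

Let `u_k` be operator-free ground states of Weil's truncated quadratic form at windows `a_k → ∞`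
(`IsWeilGroundState (a k) (u k)`), `c_k` scalars, and suppose the renormalised ground states
`f_k = c_k u_k` are bounded in ONE weighted `L¹(e^{b₀|t|} dt)` with `b₀ > 1/2` and converge weakly
against test functions to `v` (`∫ f_k g → ∫ v g` for every Weil test `g`).  Then

* `weakLimit_harmonic` — **`W(v ⋆ g̃) = 0` for every test `g`**: the limit is annihilated by the
  explicit-formula functional (the VARIATIONAL half of card `harmonic-weak-limit-closure`'s first
  lemma; RH-free).  Proof: by the strong Euler–Lagrange equation (H4,
  `IsWeilGroundState.weilFunctional_weilConv_weilReflect_eq`) `W(f_k ⋆ g̃) = ε(a_k) ⟨f_k, g⟩` as soon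
  as `supp g ⊆ [-a_k, a_k]`; the family `f_k ⋆ g̃` has a common exponential envelope (H3(A)) and
  converges pointwise to `v ⋆ g̃` (H3(B)), so `W(f_k ⋆ g̃) → W(v ⋆ g̃)` by dominated convergence of
  the Weil functional on the exponential class (H1, H2); on the other side the RH-free energy
  dichotomy (`tendsto_weilGroundEnergy_zero_or_atBot`): if `ε → 0` then
  `ε(a_k)⟨f_k, g⟩ → 0 · ⟨v, g⟩ = 0`; if `ε → -∞` then RH fails, so by
  `riemannHypothesis_of_tight_weakLimit_ne_zero` every pairing `⟨v, g⟩` vanishes, `v = 0` a.e.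
  (`ae_eq_zero_of_integral_contDiff_smul_eq_zero`) and `W(0 ⋆ g̃) = W(0) = 0`.
* `weakLimit_weilMellin_eq_zero` — hence (rev L10g `harmonic_closure`) **`v̂(ρ) = 0` at EVERY
  non-trivial zero `ρ`**, on the critical line or not.
* `weakLimit_harmonic_of_locallyIntegrable` — the same with the integrability hypothesis on `v`
  replaced by local integrability (H5: weighted `L¹` norms are weakly lower semicontinuous,
  `∫‖v‖e^{b₀|t|} ≤ M`).
* `weakLimit_dichotomy` — **RH-free dichotomy for tight weak limits**: either `v = 0` a.e., or
  RH holds, `ε(a) → 0`, `v` is Weil-harmonic and `v̂` vanishes on the whole non-trivial zero set.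
* `exists_weilHarmonic_not_const_mul_phi` — **non-rigidity of the harmonic class** (H6): for
  `x ≠ 0` the symmetrised translate `v_x = (τ_xΦ + τ_{-x}Φ)/2` of Riemann's kernel `Φ = 2Ψ(2·)` is
  real, even, strictly positive, smooth with all derivatives `O(e^{-|t|})` and itself `O(e^{-b|t|})`
  for every `b`, Weil-harmonic, with `v̂_x = cosh((s-½)x)·ξ(s)`, and is NOT a scalar multiple of `Φ`.
  So the properties of a limit that the explicit formula can see (harmonicity, parity, positivity,
  decay, zero location) do not identify `Φ`: the identification step of the crux (IDENT, CCM25 §8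
  step 2) has to use finite-window minimality.

Bearing on the crux (`GroundStatesConvergeToXi`, ≥ RH): after this file the crux factors RH-free as
NV (some `b₀ > 1/2`-tight renormalised sequence of ground states has a non-zero weak limit; ⇒ RH by
c0) × IDENT (that limit is `c·Φ`; ⇒ the crux by the landed transfer), with every non-zero tight
weak limit already Weil-harmonic and Mellin-vanishing on the zeros.

Mathlib + proved tree files only (the six rev-L11 stubs H1–H6, `harmonic_closure`,
`riemannHypothesis_of_tight_weakLimit_ne_zero`, `tendsto_weilGroundEnergy_zero_or_atBot`); no
named fact is used; no definitions.
-/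

noncomputable section

set_option linter.dupNamespace false

open scoped Topology Real ComplexConjugate
open Filter Set MeasureTheory Complex

namespace Summit.RiemannHypothesis.RiemannHypothesis.Theorems.GroundStatesConvergeToXi

open Literature.NumberTheory.LFunctions

/-! ## Glue: the Weil functional under dominated pointwise convergence (H2 ∘ H1) -/

/-- **Continuity of the Weil functional on the exponential class under dominated pointwise
convergence** (H2 ∘ H1): smooth `F_k` with a common envelope `‖F_k‖, ‖F_k'‖, ‖F_k''‖ ≤ C e^{-b₀|t|}`,
`b₀ > 1/2`, converging pointwise to a continuous `G` have `W(F_k) → W(G)`. [folklore] -/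
theorem tendsto_weilFunctional_of_dominated {F : ℕ → ℝ → ℂ} {G : ℝ → ℂ} {C b₀ : ℝ}
    (hb : 1 / 2 < b₀) (hF : ∀ k, ContDiff ℝ (⊤ : ℕ∞) (F k)) (hG : Continuous G)
    (h0 : ∀ k t, ‖F k t‖ ≤ C * Real.exp (-(b₀ * |t|)))
    (h1 : ∀ k t, ‖deriv (F k) t‖ ≤ C * Real.exp (-(b₀ * |t|)))
    (h2 : ∀ k t, ‖deriv (deriv (F k)) t‖ ≤ C * Real.exp (-(b₀ * |t|)))
    (hlim : ∀ t, Tendsto (fun k => F k t) atTop (𝓝 (G t))) :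
    Tendsto (fun k => weilFunctional (F k)) atTop (𝓝 (weilFunctional G)) :=
  (stub_weilFunctional_dominated stub_weilArchPolar_dominated F G C b₀ hb hF hG h0 h1 h2 hlim).2

/-- **The weak Euler–Lagrange equation for the ground state itself** (H4 ∘ H2 ∘ H1, H3(A);
Bombieri 2000 §4 (4.2)): `W(u ⋆ h̃) = ε(a) ∫ u h̄` for every ground state `u` at window `a` and every
test `h` supported in the window. [cite: Bombieri2000, §4 (4.2)] -/
theorem _root_.Literature.NumberTheory.LFunctions.IsWeilGroundState.weilFunctional_eq_energy_mul
    {a : ℝ} {u : ℝ → ℂ} (hu : IsWeilGroundState a u) {h : ℝ → ℂ} (hh : IsWeilTest h)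
    (hhs : tsupport h ⊆ Icc (-a) a) :
    weilFunctional (weilConv u (weilReflect h)) =
      (weilGroundEnergy a : ℂ) * ∫ t, u t * conj (h t) :=
  hu.weilFunctional_weilConv_weilReflect_eq
    (fun _ _ _ _ hb hF hG h0 h1 h2 hlim => tendsto_weilFunctional_of_dominated hb hF hG h0 h1 h2 hlim)
    stub_weilConv_pairing.1 hh hhs

/-! ## Small facts -/

/-- A test function is supported in some symmetric interval `[-R, R]`. [folklore] -/
theorem exists_tsupport_subset_Icc {g : ℝ → ℂ} (hg : IsWeilTest g) :
    ∃ R : ℝ, tsupport g ⊆ Icc (-R) R := by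
  obtain ⟨R, hR⟩ := hg.2.isCompact.isBounded.subset_closedBall 0
  refine ⟨R, fun t ht => ?_⟩
  have h := hR ht
  rw [Real.closedBall_eq_Icc, zero_sub, zero_add] at h
  exact h

/-- A real-valued smooth compactly supported function, viewed in `ℂ`, is a Weil test. [folklore] -/
theorem isWeilTest_ofReal_comp {g : ℝ → ℝ} (hg : ContDiff ℝ (⊤ : ℕ∞) g)
    (hgs : HasCompactSupport g) : IsWeilTest fun t => (g t : ℂ) :=
  ⟨Complex.ofRealCLM.contDiff.comp hg, hgs.comp_left (g := Complex.ofReal) Complex.ofReal_zero⟩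

/-- A locally integrable function pairing to `0` with every Weil test function vanishes a.e.
[folklore] -/
theorem ae_eq_zero_of_forall_isWeilTest {v : ℝ → ℂ} (hv : LocallyIntegrable v volume)
    (h : ∀ g : ℝ → ℂ, IsWeilTest g → ∫ t, v t * g t = 0) : v =ᵐ[volume] 0 := by
  refine ae_eq_zero_of_integral_contDiff_smul_eq_zero hv fun g hg hgs => ?_
  have h1 := h _ (isWeilTest_ofReal_comp hg hgs)
  rw [← h1]
  refine integral_congr_ae (ae_of_all _ fun t => ?_)
  simp only [Complex.real_smul]
  ring

/-- Convolution with an a.e.-zero function vanishes identically. [folklore] -/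
theorem weilConv_eq_zero_of_ae_eq_zero {v : ℝ → ℂ} (hv : v =ᵐ[volume] 0) (h : ℝ → ℂ) :
    weilConv v h = fun _ => 0 := by
  funext x
  rw [weilConv_apply]
  refine integral_eq_zero_of_ae ?_
  filter_upwards [hv] with t ht
  simp [ht]

/-! ## The main theorem -/

/-- **Tight weak limits of renormalised ground states are Weil-harmonic (RH-free).**  Let `u_k`
be ground states at windows `a_k → ∞`, `c_k` scalars with `∫ ‖c_k u_k‖ e^{b₀|t|} ≤ M` for ONE
`b₀ > 1/2`, and let `c_k u_k → v` weakly against test functions, `v` a.e.-strongly measurable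
with `∫ ‖v‖ e^{b₀|t|} < ∞`.  Then `W(v ⋆ g̃) = 0` for every test function `g`. [folklore] -/
theorem weakLimit_harmonic {a : ℕ → ℝ} {u : ℕ → ℝ → ℂ} {c : ℕ → ℂ} {v : ℝ → ℂ} {b₀ M : ℝ}
    (ha : Tendsto a atTop atTop) (hu : ∀ k, IsWeilGroundState (a k) (u k)) (hb₀ : 1 / 2 < b₀)
    (hM : ∀ k, ∫ t, ‖c k * u k t‖ * Real.exp (b₀ * |t|) ≤ M)
    (hv : AEStronglyMeasurable v volume)
    (hvint : Integrable fun t : ℝ => ‖v t‖ * Real.exp (b₀ * |t|))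
    (hweak : ∀ g : ℝ → ℂ, IsWeilTest g →
      Tendsto (fun k => ∫ t, c k * u k t * g t) atTop (𝓝 (∫ t, v t * g t)))
    {g : ℝ → ℂ} (hg : IsWeilTest g) :
    weilFunctional (weilConv v (weilReflect g)) = 0 := by
  rcases tendsto_weilGroundEnergy_zero_or_atBot with hε | hε
  · /- Case `ε → 0`: pass to the limit in the Euler–Lagrange identities. -/
    -- the renormalised ground states as weighted-`L¹` functions
    set f : ℕ → ℝ → ℂ := fun k t => c k * u k t with hfdef
    have hfm : ∀ k, AEStronglyMeasurable (f k) volume := fun k =>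
      ((hu k).integrable.const_mul (c k)).aestronglyMeasurable
    have hfi : ∀ k, Integrable (fun t : ℝ => ‖f k t‖ * Real.exp (b₀ * |t|)) := by
      intro k
      refine (((hu k).integrable_norm_mul_exp b₀).const_mul ‖c k‖).congr
        (ae_of_all _ fun t => ?_)
      simp only [hfdef, norm_mul]
      ring
    have hb0 : (0 : ℝ) ≤ b₀ := by linarith
    -- common envelope of `F k = f k ⋆ g̃` (H3(A) at orders 0, 1, 2)
    obtain ⟨C₀, hC₀, hE₀⟩ := stub_weilConv_pairing.1 g b₀ b₀ hb0 le_rfl hg 0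
    obtain ⟨C₁, hC₁, hE₁⟩ := stub_weilConv_pairing.1 g b₀ b₀ hb0 le_rfl hg 1
    obtain ⟨C₂, hC₂, hE₂⟩ := stub_weilConv_pairing.1 g b₀ b₀ hb0 le_rfl hg 2
    set F : ℕ → ℝ → ℂ := fun k => weilConv (f k) (weilReflect g) with hFdef
    set G : ℝ → ℂ := weilConv v (weilReflect g) with hGdef
    have hFs : ∀ k, ContDiff ℝ (⊤ : ℕ∞) (F k) := fun k => (hE₀ (f k) (hfm k) (hfi k)).1
    have hGs : ContDiff ℝ (⊤ : ℕ∞) G := (hE₀ v hv hvint).1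
    set K : ℝ := (C₀ + C₁ + C₂) * max M 0 with hKdef
    have hIM : ∀ k, ∫ t, ‖f k t‖ * Real.exp (b₀ * |t|) ≤ max M 0 := fun k =>
      (hM k).trans (le_max_left _ _)
    have hbound : ∀ (Cn : ℝ), 0 ≤ Cn → Cn ≤ C₀ + C₁ + C₂ → ∀ k t,
        Cn * (∫ u, ‖f k u‖ * Real.exp (b₀ * |u|)) * Real.exp (-(b₀ * |t|)) ≤
          K * Real.exp (-(b₀ * |t|)) := by
      intro Cn hCn hle k t
      refine mul_le_mul_of_nonneg_right ?_ (Real.exp_pos _).le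
      exact mul_le_mul hle (hIM k) (integral_nonneg fun _ => by positivity) (by positivity)
    have h0 : ∀ k t, ‖F k t‖ ≤ K * Real.exp (-(b₀ * |t|)) := by
      intro k t
      have h := (hE₀ (f k) (hfm k) (hfi k)).2 t
      rw [iteratedDeriv_zero] at h
      exact h.trans (hbound C₀ hC₀ (by linarith) k t)
    have h1 : ∀ k t, ‖deriv (F k) t‖ ≤ K * Real.exp (-(b₀ * |t|)) := by
      intro k t
      have h := (hE₁ (f k) (hfm k) (hfi k)).2 t
      rw [iteratedDeriv_one] at h
      exact h.trans (hbound C₁ hC₁ (by linarith) k t)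
    have h2 : ∀ k t, ‖deriv (deriv (F k)) t‖ ≤ K * Real.exp (-(b₀ * |t|)) := by
      intro k t
      have h := (hE₂ (f k) (hfm k) (hfi k)).2 t
      rw [show (2 : ℕ) = 1 + 1 from rfl, iteratedDeriv_succ, iteratedDeriv_one] at h
      exact h.trans (hbound C₂ hC₂ (by linarith) k t)
    -- pointwise convergence of the convolutions (H3(B)) and of the Weil functional (H2 ∘ H1)
    have hpt : ∀ x, Tendsto (fun k => F k x) atTop (𝓝 (G x)) :=
      stub_weilConv_pairing.2 f v g hg hweak
    have hW : Tendsto (fun k => weilFunctional (F k)) atTop (𝓝 (weilFunctional G)) :=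
      tendsto_weilFunctional_of_dominated hb₀ hFs hGs.continuous h0 h1 h2 hpt
    -- the Euler–Lagrange identities, as soon as the window contains `supp g`
    obtain ⟨R, hR⟩ := exists_tsupport_subset_Icc hg
    have hEL : ∀ᶠ k in atTop, (weilGroundEnergy (a k) : ℂ) * ∫ t, f k t * conj (g t) =
        weilFunctional (F k) := by
      filter_upwards [ha.eventually_ge_atTop R] with k hk
      have hsupp : tsupport g ⊆ Icc (-(a k)) (a k) :=
        hR.trans (Icc_subset_Icc (by linarith) hk)
      have h := (hu k).weilFunctional_eq_energy_mul hg hsupp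
      have hconv : F k = fun t => c k * weilConv (u k) (weilReflect g) t := by
        simp only [hFdef, hfdef]
        exact weilConv_const_mul_left (c k) (u k) (weilReflect g)
      have hint : ∫ t, f k t * conj (g t) = c k * ∫ t, u k t * conj (g t) := by
        rw [← integral_const_mul]
        refine integral_congr_ae (ae_of_all _ fun t => ?_)
        simp only [hfdef]
        ring
      rw [hconv, weilFunctional_const_mul, h, hint]
      ring
    -- the right-hand sides tend to `0 · ⟨v, g⟩ = 0`
    have hP : Tendsto (fun k => ∫ t, f k t * conj (g t)) atTop (𝓝 (∫ t, v t * conj (g t))) :=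
      hweak _ (isWeilTest_conj hg)
    have hεk : Tendsto (fun k => (weilGroundEnergy (a k) : ℂ)) atTop (𝓝 0) := by
      have h : Tendsto (fun k => (weilGroundEnergy (a k) : ℂ)) atTop (𝓝 ((0 : ℝ) : ℂ)) :=
        (Complex.continuous_ofReal.tendsto 0).comp (hε.comp ha)
      rwa [Complex.ofReal_zero] at h
    have hprod := hεk.mul hP
    rw [zero_mul] at hprod
    have hW0 : Tendsto (fun k => weilFunctional (F k)) atTop (𝓝 0) := hprod.congr' hEL
    exact tendsto_nhds_unique hW hW0
  · /- Case `ε → -∞`: RH fails, the sequence is weakly null, `v = 0` a.e. -/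
    have hnRH : ¬ RiemannHypothesis :=
      not_riemannHypothesis_iff_tendsto_weilGroundEnergy_atBot.2 hε
    have hnull : ∀ g₀ : ℝ → ℂ, IsWeilTest g₀ → ∫ t, v t * g₀ t = 0 := by
      intro g₀ hg₀
      by_contra hne
      exact hnRH (riemannHypothesis_of_tight_weakLimit_ne_zero
        ⟨a, u, c, ha, hu, ⟨b₀, hb₀, M, hM⟩, fun g => ∫ t, v t * g t, hweak, g₀, hg₀, hne⟩)
    have hvL1 : Integrable v := scPair_integrable hv (by linarith) hvint
    have hv0 : v =ᵐ[volume] 0 := ae_eq_zero_of_forall_isWeilTest hvL1.locallyIntegrable hnull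
    rw [weilConv_eq_zero_of_ae_eq_zero hv0]
    -- `W(0) = 0` (cf. `RuelleBandCofiniteCriticalLine.stub_branchesContinuous_weilFunctional_zero`)
    have h := weilFunctional_const_mul 0 (fun _ : ℝ => (0 : ℂ))
    simpa using h

/-- **Tight weak limits of renormalised ground states are Mellin-pinned at the zeros (RH-free).**
Under the hypotheses of `weakLimit_harmonic`, `v̂(ρ) = 0` at EVERY non-trivial zero `ρ` of `ζ`
(`harmonic_closure`, rev L10g). [folklore] -/
theorem weakLimit_weilMellin_eq_zero {a : ℕ → ℝ} {u : ℕ → ℝ → ℂ} {c : ℕ → ℂ} {v : ℝ → ℂ}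
    {b₀ M : ℝ} (ha : Tendsto a atTop atTop) (hu : ∀ k, IsWeilGroundState (a k) (u k))
    (hb₀ : 1 / 2 < b₀) (hM : ∀ k, ∫ t, ‖c k * u k t‖ * Real.exp (b₀ * |t|) ≤ M)
    (hv : AEStronglyMeasurable v volume)
    (hvint : Integrable fun t : ℝ => ‖v t‖ * Real.exp (b₀ * |t|))
    (hweak : ∀ g : ℝ → ℂ, IsWeilTest g →
      Tendsto (fun k => ∫ t, c k * u k t * g t) atTop (𝓝 (∫ t, v t * g t)))
    {ρ : ℂ} (hρ : ρ ∈ ZetaZeros.riemannZetaNontrivialZeros) :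
    weilMellin v ρ = 0 :=
  harmonic_closure hv hb₀ hvint (fun _ hg => weakLimit_harmonic ha hu hb₀ hM hv hvint hweak hg) hρ

/-- **Hypothesis-minimal form** (H5): the weighted integrability of the limit is automatic —
a locally integrable weak limit of a `b₀`-tight sequence is `b₀`-integrable with the same bound —
so `W(v ⋆ g̃) = 0` and `v̂(ρ) = 0` hold for every locally integrable weak limit. [folklore] -/
theorem weakLimit_harmonic_of_locallyIntegrable {a : ℕ → ℝ} {u : ℕ → ℝ → ℂ} {c : ℕ → ℂ}
    {v : ℝ → ℂ} {b₀ M : ℝ} (ha : Tendsto a atTop atTop) (hu : ∀ k, IsWeilGroundState (a k) (u k))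
    (hb₀ : 1 / 2 < b₀) (hM : ∀ k, ∫ t, ‖c k * u k t‖ * Real.exp (b₀ * |t|) ≤ M)
    (hv : LocallyIntegrable v volume)
    (hweak : ∀ g : ℝ → ℂ, IsWeilTest g →
      Tendsto (fun k => ∫ t, c k * u k t * g t) atTop (𝓝 (∫ t, v t * g t))) :
    (Integrable (fun t : ℝ => ‖v t‖ * Real.exp (b₀ * |t|)) ∧
      ∫ t, ‖v t‖ * Real.exp (b₀ * |t|) ≤ M) ∧
    (∀ g : ℝ → ℂ, IsWeilTest g → weilFunctional (weilConv v (weilReflect g)) = 0) ∧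
    ∀ ρ : ℂ, ρ ∈ ZetaZeros.riemannZetaNontrivialZeros → weilMellin v ρ = 0 := by
  have hfm : ∀ k, AEStronglyMeasurable (fun t => c k * u k t) volume := fun k =>
    ((hu k).integrable.const_mul (c k)).aestronglyMeasurable
  have hfi : ∀ k, Integrable (fun t : ℝ => ‖c k * u k t‖ * Real.exp (b₀ * |t|)) := by
    intro k
    refine (((hu k).integrable_norm_mul_exp b₀).const_mul ‖c k‖).congr
      (ae_of_all _ fun t => ?_)
    simp only [norm_mul]
    ring
  obtain ⟨hvint, hle⟩ := stub_weightedL1_of_weakLimit (fun k t => c k * u k t) v b₀ M hfm hfi hM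
    hv hweak
  have hvm : AEStronglyMeasurable v volume := hv.aestronglyMeasurable
  exact ⟨⟨hvint, hle⟩, fun g hg => weakLimit_harmonic ha hu hb₀ hM hvm hvint hweak hg,
    fun ρ hρ => weakLimit_weilMellin_eq_zero ha hu hb₀ hM hvm hvint hweak hρ⟩

/-- **RH-free dichotomy for tight weak limits of renormalised ground states.**  Either the limit
vanishes a.e., or: the Riemann hypothesis holds, the ground energy tends to `0`, the limit is
Weil-harmonic and its Mellin transform vanishes at every non-trivial zero. [folklore] -/
theorem weakLimit_dichotomy {a : ℕ → ℝ} {u : ℕ → ℝ → ℂ} {c : ℕ → ℂ} {v : ℝ → ℂ} {b₀ M : ℝ}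
    (ha : Tendsto a atTop atTop) (hu : ∀ k, IsWeilGroundState (a k) (u k)) (hb₀ : 1 / 2 < b₀)
    (hM : ∀ k, ∫ t, ‖c k * u k t‖ * Real.exp (b₀ * |t|) ≤ M) (hv : LocallyIntegrable v volume)
    (hweak : ∀ g : ℝ → ℂ, IsWeilTest g →
      Tendsto (fun k => ∫ t, c k * u k t * g t) atTop (𝓝 (∫ t, v t * g t))) :
    v =ᵐ[volume] 0 ∨
      (RiemannHypothesis ∧ Tendsto weilGroundEnergy atTop (𝓝 0) ∧
        (∀ g : ℝ → ℂ, IsWeilTest g → weilFunctional (weilConv v (weilReflect g)) = 0) ∧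
        ∀ ρ : ℂ, ρ ∈ ZetaZeros.riemannZetaNontrivialZeros → weilMellin v ρ = 0) := by
  by_cases hnull : ∀ g : ℝ → ℂ, IsWeilTest g → ∫ t, v t * g t = 0
  · exact Or.inl (ae_eq_zero_of_forall_isWeilTest hv hnull)
  · right
    push Not at hnull
    obtain ⟨g₀, hg₀, hne⟩ := hnull
    have hRH : RiemannHypothesis := riemannHypothesis_of_tight_weakLimit_ne_zero
      ⟨a, u, c, ha, hu, ⟨b₀, hb₀, M, hM⟩, fun g => ∫ t, v t * g t, hweak, g₀, hg₀, hne⟩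
    obtain ⟨-, hharm, hzero⟩ := weakLimit_harmonic_of_locallyIntegrable ha hu hb₀ hM hv hweak
    exact ⟨hRH, tendsto_weilGroundEnergy_zero_of_riemannHypothesis hRH, hharm, hzero⟩

/-- **Stub H7 — `weakLimit_harmonic` (registered LEAD assembly stub of rev L11; RH-free).**
Uncurried form of `weakLimit_harmonic_of_locallyIntegrable`: tight weak limits of renormalised
ground states are weighted-integrable with the same bound, Weil-harmonic, and Mellin-vanishing at
every non-trivial zero. [folklore] -/
theorem stub_weakLimit_harmonic :
    ∀ (a : ℕ → ℝ) (u : ℕ → ℝ → ℂ) (c : ℕ → ℂ) (v : ℝ → ℂ) (b₀ M : ℝ),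
      Tendsto a atTop atTop → (∀ k, IsWeilGroundState (a k) (u k)) → 1 / 2 < b₀ →
      (∀ k, ∫ t, ‖c k * u k t‖ * Real.exp (b₀ * |t|) ≤ M) →
      LocallyIntegrable v volume →
      (∀ g : ℝ → ℂ, IsWeilTest g →
        Tendsto (fun k => ∫ t, c k * u k t * g t) atTop (𝓝 (∫ t, v t * g t))) →
      (Integrable (fun t : ℝ => ‖v t‖ * Real.exp (b₀ * |t|)) ∧
        ∫ t, ‖v t‖ * Real.exp (b₀ * |t|) ≤ M) ∧
      (∀ g : ℝ → ℂ, IsWeilTest g → weilFunctional (weilConv v (weilReflect g)) = 0) ∧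
      ∀ ρ : ℂ, ρ ∈ ZetaZeros.riemannZetaNontrivialZeros → weilMellin v ρ = 0 :=
  fun _ _ _ _ _ _ ha hu hb₀ hM hv hweak =>
    weakLimit_harmonic_of_locallyIntegrable ha hu hb₀ hM hv hweak

/-! ## Non-rigidity of the harmonic class (H6) -/

/-- **Weil-harmonicity, reality, evenness, positivity, Schwartz-exponential decay and a
`cosh`-factor transform do not single out Riemann's kernel.**  There is a function `w : ℝ → ℂ`
(namely `w = (τ_xΦ + τ_{-x}Φ)/2` for any `x ≠ 0`, `Φ = 2Ψ(2·)`) which is real-valued, strictly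
positive, even, smooth with every derivative `O(e^{-|t|})` and itself `O(e^{-b|t|})` for every `b`,
WEIL-HARMONIC (`W(w ⋆ g̃) = 0` for all tests `g`), whose Mellin transform is `cosh((s-½)x)·ξ(s)`
(extra zeros only on the critical line), and which is NOT a scalar multiple of `Φ`.  Consequence
for the crux: the identification "tight weak limit = c·Φ" is not a consequence of any property of
the limit visible to the explicit formula. [folklore] -/
theorem exists_weilHarmonic_not_const_mul_phi :
    ∃ w : ℝ → ℂ, ∃ x : ℝ, x ≠ 0 ∧ (∀ t, (w t).im = 0) ∧ (∀ t, 0 < (w t).re) ∧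
      (∀ t, w (-t) = w t) ∧ ContDiff ℝ (⊤ : ℕ∞) w ∧
      (∀ n : ℕ, ∃ C : ℝ, ∀ t, ‖iteratedDeriv n w t‖ ≤ C * Real.exp (-(1 * |t|))) ∧
      (∀ b : ℝ, ∃ C : ℝ, ∀ t, ‖w t‖ ≤ C * Real.exp (-(b * |t|))) ∧
      (∀ s : ℂ, weilMellin w s = Complex.cosh ((s - 1 / 2) * (x : ℂ)) * riemannXi s) ∧
      (∀ g : ℝ → ℂ, IsWeilTest g → weilFunctional (weilConv w (weilReflect g)) = 0) ∧
      ∀ c : ℂ, ¬ ∀ t : ℝ, w t = c * (2 * LagariasMontague.Psic (2 * t)) := by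
  obtain ⟨him, hre, hev, hcd, hder, hbd, hmel, hharm, hnot⟩ := stub_phi_translateAvg_harmonic 1
  refine ⟨fun t => LagariasMontague.Psic (2 * (t + 1)) + LagariasMontague.Psic (2 * (t - 1)), 1,
    one_ne_zero, him, hre, fun t => ?_, hcd, hder, hbd, hmel, hharm, hnot one_ne_zero⟩
  exact hev t

end Summit.RiemannHypothesis.RiemannHypothesis.Theorems.GroundStatesConvergeToXi

end
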